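import Mathlib.Analysis.SpecificLimits.Basic
import Mathlib.Analysis.Normed.Group.FunctionSeries
import Summits.QuantumFields.BalabanUV.Gaps.EndDrawdownBand
import Summits.QuantumFields.BalabanUV.Gaps.CapSignsConstRoad

/-!
# Gaps / EndDrawdownProfile — a PROFILE remainder `β¹_{k+1}(g_0,…,g_k) = σ·Φ_t(g_k)` on the every-slope road, where the continuous profile
# `Φ_t(x) = Σ_n 2⁻ⁿ·ramp(x ∕ t_n)` is TUNED by a threshold sequence `t_n ↓` (so that `Φ_t ≥ 2⁻ⁿ` on `[2t_n, ∞)` and `Φ_t ≤ 2⁻ⁿ` on `]0, t_n]`):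
# the device by which `Gaps/EndDrawdownEverySlopeDecided` closes BOTH outer links of `EndDrawdownEverySlope.everySlope_chain` for EVERY real
# one-loop sequence (adversary `σ = −1` tuned to the failing drawdowns of `b`, cooperator `σ = +1` tuned to the drawdown bounds of `b`)
# (this seat's own leaf; cell pub-balaban-gaps, seat g1-p3 GEN 9, rows CAP ∕ tail «split ∕ weakening»; file 10 of «the one-loop interface of
# the END statement»)

HONEST FRAMING (cell rule, page 1 of everything): [folklore] real analysis (a uniformly convergent series of continuous ramps) and a TOY family on
the tree's carrier `HBeta` with its printed split; NO object of Bałaban's occurs; the profile realizations are hypothesis-free WITNESSES used to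
decide what the cell's END-grade statement `DagBinding.EndpointExistence` reads of a one-loop sequence over the every-slope realization class
(row (D4)'s located UNPRINTED currency `CapSignsConstRoad.EverySlope`).  Nothing of Bałaban's is asserted; 0∕6 binders discharged; 0 coefficients
certified; NOT [I] Thm 2, NOT `BetaPertH`, NOT the continuum limit, NOT Clay.

CONTENTS.  §1 the unit ramp and the profile `profile t` (continuity, `0 ≤ Φ ≤ 2`, the two threshold bounds `le_profile_of_two_mul_le` ∕
`profile_le_of_le`); §2 the profile realization `betaPro b σ t` = `b_k + σ·Φ_t(g_k)·𝟙[g_k > 0]`, its printed split `splitPro`, (C) on every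
box, and `EverySlope` on every box `]0,γc]` for EVERY threshold sequence (the remainder is `≤ |σ|·2⁻ⁿ` on `]0,t_n]`); §3 the realised step along
in-interval runs of a forward-generated construction (`1∕g_k² − 1∕g_{k+1}² ≤ b_k + σ Φ_t(g_k)`, window form).

CITATION HEADER (tags CONTEXT ONLY).  [I] = T. Bałaban, Commun. Math. Phys. **109** (1987) 249–301 [Balaban1987RG1]: (0.20) p. 256, Thm 2
p. 259 (first sentence), Thm 3 p. 264, (2.12)–(2.14) p. 268.
-/

namespace Summit.QuantumFields.BalabanUV.Gaps.EndDrawdownProfile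

open Literature.MathematicalPhysics.QuantumFieldTheory.Balaban1983to89
open Literature.MathematicalPhysics.QuantumFieldTheory.Balaban1983to89.FlowStep
open Literature.MathematicalPhysics.QuantumFieldTheory.Balaban1983to89.FlowStepRuns
open Literature.MathematicalPhysics.QuantumFieldTheory.Balaban1983to89.DagBinding
open Literature.MathematicalPhysics.QuantumFieldTheory.Balaban1983to89.Beta.RemainderChain (RemainderConst)
open Summit.QuantumFields.BalabanUV.Gaps.CapSignsConstRoad (EverySlope)
open Summit.QuantumFields.BalabanUV.Gaps.CapSignsNecessaryFwd (windowSum_ge_of_forwardGenerated)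
open Summit.QuantumFields.BalabanUV.Gaps.EndDrawdownSeq
open Finset

noncomputable section

/-! ## §1 The unit ramp and the profile -/

/-- The unit ramp: `0` on `]−∞,1]`, `u − 1` on `[1,2]`, `1` on `[2,∞[`. [folklore] -/
def ramp (u : ℝ) : ℝ := max 0 (min 1 (u - 1))

/-- `0 ≤ ramp u`. [folklore] -/
theorem ramp_nonneg (u : ℝ) : 0 ≤ ramp u := le_max_left _ _

/-- `ramp u ≤ 1`. [folklore] -/
theorem ramp_le_one (u : ℝ) : ramp u ≤ 1 := max_le zero_le_one (min_le_left _ _)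

/-- Below `1` the ramp vanishes. [folklore] -/
theorem ramp_of_le_one {u : ℝ} (h : u ≤ 1) : ramp u = 0 :=
  max_eq_left ((min_le_right _ _).trans (by linarith))

/-- Above `2` the ramp is `1`. [folklore] -/
theorem ramp_of_two_le {u : ℝ} (h : 2 ≤ u) : ramp u = 1 := by
  unfold ramp
  rw [min_eq_left (by linarith), max_eq_right zero_le_one]

/-- The ramp is continuous. [folklore] -/
theorem continuous_ramp : Continuous ramp :=
  continuous_const.max (continuous_const.min (continuous_id.sub continuous_const))

/-- The geometric weights `2⁻ⁿ` are summable. [folklore] -/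
theorem summable_inv_two_pow : Summable fun n : ℕ => ((2 : ℝ)⁻¹) ^ n :=
  summable_geometric_of_lt_one (by norm_num) (by norm_num)

/-- **THE PROFILE** tuned by the threshold sequence `t`: `Φ_t(x) := Σ_n 2⁻ⁿ · ramp(x ∕ t_n)`. [folklore] -/
def profile (t : ℕ → ℝ) (x : ℝ) : ℝ := ∑' n : ℕ, ((2 : ℝ)⁻¹) ^ n * ramp (x / t n)

/-- The terms of the profile are dominated by the geometric weights. [folklore] -/
theorem profile_term_le (t : ℕ → ℝ) (x : ℝ) (n : ℕ) : ((2 : ℝ)⁻¹) ^ n * ramp (x / t n) ≤ ((2 : ℝ)⁻¹) ^ n :=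
  mul_le_of_le_one_right (pow_nonneg (by norm_num) n) (ramp_le_one _)

/-- The terms of the profile are nonnegative. [folklore] -/
theorem profile_term_nonneg (t : ℕ → ℝ) (x : ℝ) (n : ℕ) : 0 ≤ ((2 : ℝ)⁻¹) ^ n * ramp (x / t n) :=
  mul_nonneg (pow_nonneg (by norm_num) n) (ramp_nonneg _)

/-- The profile series is summable at every point. [folklore] -/
theorem summable_profile (t : ℕ → ℝ) (x : ℝ) : Summable fun n : ℕ => ((2 : ℝ)⁻¹) ^ n * ramp (x / t n) :=
  Summable.of_nonneg_of_le (profile_term_nonneg t x) (profile_term_le t x) summable_inv_two_pow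

/-- **CONTINUITY** of the profile (Weierstrass M-test against `Σ 2⁻ⁿ`). [folklore] -/
theorem continuous_profile (t : ℕ → ℝ) : Continuous (profile t) := by
  unfold profile
  refine continuous_tsum (fun n => continuous_const.mul (continuous_ramp.comp (continuous_id.div_const _)))
    summable_inv_two_pow fun n x => ?_
  rw [Real.norm_eq_abs, abs_of_nonneg (profile_term_nonneg t x n)]
  exact profile_term_le t x n

/-- `0 ≤ Φ_t`. [folklore] -/
theorem profile_nonneg (t : ℕ → ℝ) (x : ℝ) : 0 ≤ profile t x := tsum_nonneg (profile_term_nonneg t x)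

/-- `Φ_t ≤ 2`. [folklore] -/
theorem profile_le_two (t : ℕ → ℝ) (x : ℝ) : profile t x ≤ 2 :=
  calc profile t x ≤ ∑' n : ℕ, ((2 : ℝ)⁻¹) ^ n :=
        (summable_profile t x).tsum_le_tsum (profile_term_le t x) summable_inv_two_pow
    _ = 2 := tsum_geometric_inv_two

/-- **LOWER THRESHOLD BOUND**: past the doubled `n`-th threshold the `n`-th ramp is saturated, `2 t_n ≤ x ⟹ 2⁻ⁿ ≤ Φ_t(x)` (`0 < t_n`). [folklore] -/
theorem le_profile_of_two_mul_le {t : ℕ → ℝ} {n : ℕ} (htn : 0 < t n) {x : ℝ} (hx : 2 * t n ≤ x) :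
    ((2 : ℝ)⁻¹) ^ n ≤ profile t x := by
  have hr : ramp (x / t n) = 1 := ramp_of_two_le (by rwa [le_div_iff₀ htn])
  have h := (summable_profile t x).le_tsum n fun j _ => profile_term_nonneg t x j
  rw [hr, mul_one] at h
  exact h

/-- **UPPER THRESHOLD BOUND**: below the `n`-th threshold of an antitone positive threshold sequence the first `n + 1` ramps vanish,
`x ≤ t_n ⟹ Φ_t(x) ≤ Σ_{m>n} 2⁻ᵐ = 2⁻ⁿ`. [folklore] -/
theorem profile_le_of_le {t : ℕ → ℝ} (hanti : Antitone t) (hpos : ∀ n, 0 < t n) {n : ℕ} {x : ℝ} (hx : x ≤ t n) :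
    profile t x ≤ ((2 : ℝ)⁻¹) ^ n := by
  have hdom : ∀ m : ℕ, ((2 : ℝ)⁻¹) ^ m * ramp (x / t m) ≤ if n + 1 ≤ m then ((2 : ℝ)⁻¹) ^ m else 0 := by
    intro m
    split_ifs with hm
    · exact profile_term_le t x m
    · have hmn : m ≤ n := by omega
      have hxm : x / t m ≤ 1 := by
        rw [div_le_one (hpos m)]
        exact hx.trans (hanti hmn)
      rw [ramp_of_le_one hxm, mul_zero]
  have hsum : Summable fun m : ℕ => if n + 1 ≤ m then ((2 : ℝ)⁻¹) ^ m else 0 :=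
    Summable.of_nonneg_of_le (fun m => by split_ifs <;> positivity)
      (fun m => by split_ifs <;> simp [pow_nonneg]) summable_inv_two_pow
  calc profile t x ≤ ∑' m : ℕ, (if n + 1 ≤ m then ((2 : ℝ)⁻¹) ^ m else 0) :=
        (summable_profile t x).tsum_le_tsum hdom hsum
    _ = 2 * ((2 : ℝ)⁻¹) ^ (n + 1) := tsum_geometric_inv_two_ge (n + 1)
    _ = ((2 : ℝ)⁻¹) ^ n := by rw [pow_succ]; ring

/-- Every positive number dominates some weight `2⁻ⁿ`. [folklore] -/
theorem exists_inv_two_pow_lt {s : ℝ} (hs : 0 < s) : ∃ n : ℕ, ((2 : ℝ)⁻¹) ^ n < s :=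
  exists_pow_lt_of_lt_one hs (by norm_num)

/-! ## §2 The profile realization on the tree's carrier: `β_{k+1}(g_0,…,g_k) = b_k + σ·Φ_t(g_k)·𝟙[g_k > 0]` -/

/-- THE PROFILE FAMILY · one-loop part `b`, remainder `σ·Φ_t(g_k)` on histories with positive last coupling (`0` at `g_k = 0`: the printed vanishing);
`σ = −1` is the tuned ADVERSARY, `σ = +1` the tuned COOPERATOR of `Gaps/EndDrawdownEverySlopeDecided`.  A TOY on the tree's carrier. [folklore] -/
def betaPro (b : ℕ → ℝ) (σ : ℝ) (t : ℕ → ℝ) : HBeta := fun k p =>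
  b k + (if 0 < p (Fin.last k) then σ * profile t (p (Fin.last k)) else 0)

/-- Its printed split: `β⁰ := b`, `β¹ := σ·Φ_t(g_k)·𝟙[g_k > 0]`. [folklore] -/
def splitPro (b : ℕ → ℝ) (σ : ℝ) (t : ℕ → ℝ) : B12Beta.OneLoopSplit (betaPro b σ t) where
  β0 := b
  β1 := fun k p => if 0 < p (Fin.last k) then σ * profile t (p (Fin.last k)) else 0
  split := fun _ _ => rfl
  vanish := fun k p hp => by simp [hp]

/-- On a history with positive last coupling: `β_{k+1} = b_k + σ Φ_t(g_k)`. [folklore] -/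
theorem betaPro_of_pos (b : ℕ → ℝ) (σ : ℝ) (t : ℕ → ℝ) (k : ℕ) {p : Fin (k + 1) → ℝ} (hp : 0 < p (Fin.last k)) :
    betaPro b σ t k p = b k + σ * profile t (p (Fin.last k)) := by
  simp [betaPro, hp]

/-- (C) for the profile family on EVERY box (the profile is continuous). [folklore] -/
theorem betaContH_betaPro (b : ℕ → ℝ) (σ : ℝ) (t : ℕ → ℝ) (γ : ℝ) : BetaContH γ (betaPro b σ t) := fun k =>
  (continuousOn_const.add (continuousOn_const.mul
    ((continuous_profile t).comp_continuousOn (continuous_apply (Fin.last k)).continuousOn))).congr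
    fun _ hp => betaPro_of_pos b σ t k ((mem_box.mp hp) (Fin.last k)).1

/-- The remainder is bounded by `|σ|·2⁻ⁿ` on the `]0,t_n]`-histories (antitone positive thresholds). [folklore] -/
theorem remainderConst_splitPro (b : ℕ → ℝ) (σ : ℝ) {t : ℕ → ℝ} (hanti : Antitone t) (hpos : ∀ n, 0 < t n) (n : ℕ) {γ : ℝ}
    (hγ : γ ≤ t n) : RemainderConst (splitPro b σ t) γ (|σ| * ((2 : ℝ)⁻¹) ^ n) := by
  intro k p hp
  have hlast := hp (Fin.last k)
  show |(if 0 < p (Fin.last k) then σ * profile t (p (Fin.last k)) else 0)| ≤ |σ| * ((2 : ℝ)⁻¹) ^ n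
  rw [if_pos hlast.1, abs_mul, abs_of_nonneg (profile_nonneg t _)]
  exact mul_le_mul_of_nonneg_left (profile_le_of_le hanti hpos (hlast.2.trans hγ)) (abs_nonneg σ)

/-- **THE PROFILE FAMILY IS ON THE EVERY-SLOPE ROAD** on every box `]0,γc]` (`0 < γc`), for EVERY sign∕size `σ` and EVERY antitone positive
threshold sequence: given `s > 0` take `n` with `|σ|·2⁻ⁿ ≤ s` and the box `]0, min γc t_n]`. [folklore] -/
theorem everySlope_splitPro (b : ℕ → ℝ) (σ : ℝ) {t : ℕ → ℝ} (hanti : Antitone t) (hpos : ∀ n, 0 < t n) {γc : ℝ} (hγc : 0 < γc) :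
    EverySlope (splitPro b σ t) γc := by
  intro s hs
  obtain ⟨n, hn⟩ := exists_inv_two_pow_lt (show 0 < s / (|σ| + 1) by positivity)
  refine ⟨min γc (t n), lt_min hγc (hpos n), min_le_left _ _, fun k p hp => ?_⟩
  have h := remainderConst_splitPro b σ hanti hpos n (min_le_right γc (t n)) k p hp
  have h2 : |σ| * ((2 : ℝ)⁻¹) ^ n ≤ s := by
    have h3 : |σ| * ((2 : ℝ)⁻¹) ^ n ≤ (|σ| + 1) * (s / (|σ| + 1)) :=
      mul_le_mul (by linarith [abs_nonneg σ]) hn.le (pow_nonneg (by norm_num) n) (by positivity)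
    rwa [mul_div_cancel₀ _ (by positivity : (|σ| + 1 : ℝ) ≠ 0)] at h3
  exact h.trans h2

/-! ## §3 The realised step along in-interval runs of a forward-generated construction -/

/-- REALISED WINDOW INEQUALITY for the profile family: along a run of a forward-generated construction of `betaPro b σ t` that stays in `]0,γ]`
up to `K`, `1∕g_k² − 1∕g_n² ≤ Σ_{j∈[k,n)} (b_j + σ Φ_t(g_j))` for `k ≤ n ≤ K` (`CapSignsNecessaryFwd.windowSum_ge_of_forwardGenerated`, the
couplings being positive). [cite: Balaban1987RG1, (0.20) p.256] -/
theorem windowSum_ge_betaPro {b : ℕ → ℝ} {σ : ℝ} {t : ℕ → ℝ} {C : B12.Construction} (hgen : ForwardGenerated C (betaPro b σ t))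
    (P : B12.RunParams) {γ : ℝ} (hI : (C P).flow.InInterval γ P.K) {k n : ℕ} (hkn : k ≤ n) (hn : n ≤ P.K) :
    1 / ((C P).flow.g k) ^ 2 - 1 / ((C P).flow.g n) ^ 2 ≤
      ∑ j ∈ Finset.Ico k n, (b j + σ * profile t ((C P).flow.g j)) := by
  have h := windowSum_ge_of_forwardGenerated hgen P hI hkn hn
  have hterm : ∀ j ∈ Finset.Ico k n, betaPro b σ t j (prefixOf (C P).flow.g j) = b j + σ * profile t ((C P).flow.g j) :=
    fun j hj => by
      rw [betaPro_of_pos b σ t j (by simpa using (hI j ((Finset.mem_Ico.mp hj).2.le.trans hn)).1)]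
      simp
  rwa [Finset.sum_congr rfl hterm] at h

/-! ## §4 The TUNED ADVERSARY: if `b` has bounded drawdown below NO line of positive slope, some every-slope realization of `b` has no END

From `¬ DwSeq b 2⁻ⁿ` for every `n` pick a window `[k_n, K_n)` on which `Σ (b − 2⁻ⁿ)` falls below `−(n+1)` while all its suffix sums are `≤ 0`
(an argmin), put `x_n := (n + 1 + 2⁻ⁿ(K_n − k_n))^{−1∕2}` and tune the thresholds so that `2 t_n ≤ x_n`.  Along a run of ANY forward-generated
construction of `β = b − Φ_t(g_k)` in a box, ending at `g_{K_n} = (n+1)^{−1∕2}`: the realised window inequality and the suffix bound give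
`1∕g_j² ≤ n + 1 + 2⁻ⁿ(K_n − j) ≤ 1∕x_n²` on the window, so `g_j ≥ x_n ≥ 2t_n`, so the penalty is `Φ_t(g_j) ≥ 2⁻ⁿ` at EVERY step of the window,
whence `1∕g_{k_n}² ≤ (n+1) + Σ_{[k_n,K_n)} (b − 2⁻ⁿ) < 0` — absurd.  As `E` offers targets `g ≤ g⋆` at every level `n ≥ 1∕g⋆² − 1`, no box works. -/

section Adversary

variable {b : ℕ → ℝ}

/-- ARGMIN REFINEMENT of a failing drawdown: if `¬ DwSeq b r` then for every `M` there is a window `[k,K)` with `Σ_{[k,K)} (b − r) < −M` all of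
whose suffix sums are nonpositive, `Σ_{[j,K)} (b − r) ≤ 0` for `k ≤ j ≤ K`. [folklore] -/
theorem exists_window_of_not_dwSeq {r : ℝ} (h : ¬ DwSeq b r) (M : ℝ) :
    ∃ kK : ℕ × ℕ, kK.1 ≤ kK.2 ∧ ∑ j ∈ Finset.Ico kK.1 kK.2, (b j - r) < -M ∧
      ∀ j, kK.1 ≤ j → j ≤ kK.2 → ∑ i ∈ Finset.Ico j kK.2, (b i - r) ≤ 0 := by
  simp only [DwSeq, not_exists, not_forall, not_le] at h
  obtain ⟨k, n, hkn, hlt⟩ := h M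
  obtain ⟨K, hK, hmin⟩ := Finset.exists_min_image (Finset.Icc k n) (fun j => ∑ i ∈ Finset.Ico k j, (b i - r))
    ⟨n, Finset.mem_Icc.mpr ⟨hkn, le_rfl⟩⟩
  have hkK : k ≤ K := (Finset.mem_Icc.mp hK).1
  have hKn : K ≤ n := (Finset.mem_Icc.mp hK).2
  refine ⟨(k, K), hkK, ?_, fun j hkj hjK => ?_⟩
  · have h1 := hmin n (Finset.mem_Icc.mpr ⟨hkn, le_rfl⟩)
    exact lt_of_le_of_lt h1 hlt
  · have h2 := hmin j (Finset.mem_Icc.mpr ⟨hkj, hjK.trans hKn⟩)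
    have hsplit := Finset.sum_Ico_consecutive (fun i => b i - r) hkj hjK
    linarith

/-- The adversary's window at level `n` (threshold `2⁻ⁿ`, deficit `n + 1`), chosen once and for all. [folklore] -/
def advWin (h : ∀ n : ℕ, ¬ DwSeq b (((2 : ℝ)⁻¹) ^ n)) (n : ℕ) : ℕ × ℕ :=
  Classical.choose (exists_window_of_not_dwSeq (h n) ((n : ℝ) + 1))

/-- Its specification. [folklore] -/
theorem advWin_spec (h : ∀ n : ℕ, ¬ DwSeq b (((2 : ℝ)⁻¹) ^ n)) (n : ℕ) :
    (advWin h n).1 ≤ (advWin h n).2 ∧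
      ∑ j ∈ Finset.Ico (advWin h n).1 (advWin h n).2, (b j - ((2 : ℝ)⁻¹) ^ n) < -((n : ℝ) + 1) ∧
      ∀ j, (advWin h n).1 ≤ j → j ≤ (advWin h n).2 →
        ∑ i ∈ Finset.Ico j (advWin h n).2, (b i - ((2 : ℝ)⁻¹) ^ n) ≤ 0 :=
  Classical.choose_spec (exists_window_of_not_dwSeq (h n) ((n : ℝ) + 1))

/-- The coupling floor of level `n`: `x_n := (n + 1 + 2⁻ⁿ·(K_n − k_n))^{−1∕2}`. [folklore] -/
def advX (h : ∀ n : ℕ, ¬ DwSeq b (((2 : ℝ)⁻¹) ^ n)) (n : ℕ) : ℝ :=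
  1 / Real.sqrt ((n : ℝ) + 1 + ((2 : ℝ)⁻¹) ^ n * (((advWin h n).2 : ℝ) - (advWin h n).1))

/-- `0 < n + 1 + 2⁻ⁿ(K_n − k_n)`. [folklore] -/
theorem advX_rad_pos (h : ∀ n : ℕ, ¬ DwSeq b (((2 : ℝ)⁻¹) ^ n)) (n : ℕ) :
    0 < (n : ℝ) + 1 + ((2 : ℝ)⁻¹) ^ n * (((advWin h n).2 : ℝ) - (advWin h n).1) := by
  have hL : (0 : ℝ) ≤ ((advWin h n).2 : ℝ) - (advWin h n).1 := by
    have := (advWin_spec h n).1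
    exact sub_nonneg.mpr (by exact_mod_cast this)
  positivity

/-- `0 < x_n`. [folklore] -/
theorem advX_pos (h : ∀ n : ℕ, ¬ DwSeq b (((2 : ℝ)⁻¹) ^ n)) (n : ℕ) : 0 < advX h n :=
  div_pos one_pos (Real.sqrt_pos.mpr (advX_rad_pos h n))

/-- `1∕x_n² = n + 1 + 2⁻ⁿ(K_n − k_n)`. [folklore] -/
theorem inv_sq_advX (h : ∀ n : ℕ, ¬ DwSeq b (((2 : ℝ)⁻¹) ^ n)) (n : ℕ) :
    1 / advX h n ^ 2 = (n : ℝ) + 1 + ((2 : ℝ)⁻¹) ^ n * (((advWin h n).2 : ℝ) - (advWin h n).1) := by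
  rw [advX, div_pow, one_pow, Real.sq_sqrt (advX_rad_pos h n).le, one_div_one_div]

/-- The adversary's thresholds: `t_n := 2⁻ⁿ⁻¹ ∕ (1 + Σ_{i≤n} 1∕x_i)` — positive, antitone, `2 t_n ≤ x_n`. [folklore] -/
def advT (h : ∀ n : ℕ, ¬ DwSeq b (((2 : ℝ)⁻¹) ^ n)) (n : ℕ) : ℝ :=
  ((2 : ℝ)⁻¹) ^ (n + 1) / (1 + ∑ i ∈ Finset.range (n + 1), 1 / advX h i)

/-- The denominators are `≥ 1`. [folklore] -/
theorem advT_den_pos (h : ∀ n : ℕ, ¬ DwSeq b (((2 : ℝ)⁻¹) ^ n)) (n : ℕ) :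
    1 ≤ 1 + ∑ i ∈ Finset.range (n + 1), 1 / advX h i :=
  le_add_of_nonneg_right (Finset.sum_nonneg fun i _ => (one_div_pos.mpr (advX_pos h i)).le)

/-- `0 < t_n`. [folklore] -/
theorem advT_pos (h : ∀ n : ℕ, ¬ DwSeq b (((2 : ℝ)⁻¹) ^ n)) (n : ℕ) : 0 < advT h n :=
  div_pos (pow_pos (by norm_num) _) (lt_of_lt_of_le one_pos (advT_den_pos h n))

/-- The thresholds are antitone. [folklore] -/
theorem advT_antitone (h : ∀ n : ℕ, ¬ DwSeq b (((2 : ℝ)⁻¹) ^ n)) : Antitone (advT h) := by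
  refine antitone_nat_of_succ_le fun n => ?_
  unfold advT
  have hd := advT_den_pos h n
  have hstep : 1 + ∑ i ∈ Finset.range (n + 1), 1 / advX h i ≤ 1 + ∑ i ∈ Finset.range (n + 1 + 1), 1 / advX h i := by
    rw [Finset.sum_range_succ _ (n + 1)]
    linarith [(one_div_pos.mpr (advX_pos h (n + 1))).le]
  have hnum : ((2 : ℝ)⁻¹) ^ (n + 1 + 1) ≤ ((2 : ℝ)⁻¹) ^ (n + 1) :=
    pow_le_pow_of_le_one (by norm_num) (by norm_num) (Nat.le_succ _)
  exact div_le_div₀ (pow_nonneg (by norm_num) _) hnum (by linarith) hstep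

/-- **TUNING**: `2 t_n ≤ x_n`. [folklore] -/
theorem two_mul_advT_le (h : ∀ n : ℕ, ¬ DwSeq b (((2 : ℝ)⁻¹) ^ n)) (n : ℕ) : 2 * advT h n ≤ advX h n := by
  have hx := advX_pos h n
  have hden : 1 / advX h n ≤ 1 + ∑ i ∈ Finset.range (n + 1), 1 / advX h i := by
    have hmem : 1 / advX h n ≤ ∑ i ∈ Finset.range (n + 1), 1 / advX h i :=
      Finset.single_le_sum (f := fun i => 1 / advX h i) (fun i _ => (one_div_pos.mpr (advX_pos h i)).le)
        (Finset.mem_range.mpr (Nat.lt_succ_self n))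
    linarith
  have hpow : 2 * ((2 : ℝ)⁻¹) ^ (n + 1) ≤ 1 := by
    rw [pow_succ]
    have : ((2 : ℝ)⁻¹) ^ n ≤ 1 := pow_le_one₀ (by norm_num) (by norm_num)
    nlinarith
  unfold advT
  rw [mul_div_assoc']
  calc 2 * ((2 : ℝ)⁻¹) ^ (n + 1) / (1 + ∑ i ∈ Finset.range (n + 1), 1 / advX h i)
      ≤ 1 / (1 / advX h n) := div_le_div₀ zero_le_one hpow (one_div_pos.mpr hx) hden
    _ = advX h n := by rw [one_div_one_div]

/-- **THE TUNED ADVERSARY HAS NO END** · if `b` has bounded drawdown below no line of slope `2⁻ⁿ` (`n ∈ ℕ`), then NO forward-generated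
construction of the profile realization `β_{k+1} = b_k − Φ_t(g_k)` (thresholds `advT`) has `EndpointExistence`. [cite: Balaban1987RG1, (0.20) p.256 and Thm 2 p.259 (first sentence)] -/
theorem not_endpointExistence_adv (h : ∀ n : ℕ, ¬ DwSeq b (((2 : ℝ)⁻¹) ^ n)) {C : B12.Construction}
    (hgen : ForwardGenerated C (betaPro b (-1) (advT h))) : ¬ EndpointExistence C := by
  intro hE
  obtain ⟨γ₂, hγ₂, hγ⟩ := hE 0
  obtain ⟨gstar, hgstar, hg⟩ := hγ γ₂ hγ₂ le_rfl
  obtain ⟨n, hn⟩ := exists_nat_ge (1 / gstar ^ 2)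
  -- level-n data: window, coupling floor, tuning
  obtain ⟨hkK, hdef, hsuf⟩ := advWin_spec h n
  have hx2 := inv_sq_advX h n
  have hxpos := advX_pos h n
  have htune := two_mul_advT_le h n
  generalize (advWin h n).1 = k at hkK hdef hsuf hx2
  generalize (advWin h n).2 = K at hkK hdef hsuf hx2
  set c : ℝ := ((2 : ℝ)⁻¹) ^ n with hc
  have hc0 : 0 ≤ c := pow_nonneg (by norm_num) n
  -- the target `g = (n+1)^{-1/2} ≤ g⋆`
  set g : ℝ := 1 / Real.sqrt ((n : ℝ) + 1) with hgdef
  have hn1 : (0 : ℝ) < (n : ℝ) + 1 := by positivity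
  have hgpos : 0 < g := by positivity
  have hg2 : 1 / g ^ 2 = (n : ℝ) + 1 := by
    rw [hgdef, div_pow, one_pow, Real.sq_sqrt hn1.le, one_div_one_div]
  have hgle : g ≤ gstar := by
    have h1 : 1 / gstar ^ 2 ≤ 1 / g ^ 2 := by rw [hg2]; linarith
    have h2 : g ^ 2 ≤ gstar ^ 2 := (one_div_le_one_div (pow_pos hgstar 2) (pow_pos hgpos 2)).mp h1
    exact (pow_le_pow_iff_left₀ hgpos.le hgstar.le two_ne_zero).mp h2
  obtain ⟨g0, hI, hend⟩ := hg g hgpos hgle K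
  set P : B12.RunParams := ⟨K, 0, g0⟩ with hP
  have hend' : (C P).flow.g K = g := hend
  have hposj : ∀ j, j ≤ K → 0 < (C P).flow.g j := fun j hj => (hI j hj).1
  -- on the window every coupling is ≥ x_n, so every penalty is ≥ 2⁻ⁿ
  have hpen : ∀ j, k ≤ j → j < K → c ≤ profile (advT h) ((C P).flow.g j) := by
    intro j hkj hjK
    have hw := windowSum_ge_betaPro hgen P hI hjK.le le_rfl
    rw [hend', hg2] at hw
    have hsum_le : ∑ i ∈ Finset.Ico j K, (b i + (-1) * profile (advT h) ((C P).flow.g i)) ≤ ∑ i ∈ Finset.Ico j K, b i :=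
      Finset.sum_le_sum fun i _ => by linarith [profile_nonneg (advT h) ((C P).flow.g i)]
    have hb : ∑ i ∈ Finset.Ico j K, b i = ∑ i ∈ Finset.Ico j K, (b i - c) + c * ((K : ℝ) - j) := by
      rw [sum_Ico_sub_const b c hjK.le]; ring
    have hsuf' := hsuf j hkj hjK.le
    have hKj : c * ((K : ℝ) - j) ≤ c * ((K : ℝ) - k) := by
      have : (k : ℝ) ≤ j := by exact_mod_cast hkj
      exact mul_le_mul_of_nonneg_left (by linarith) hc0
    have hyj : 1 / ((C P).flow.g j) ^ 2 ≤ 1 / advX h n ^ 2 := by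
      rw [hx2]
      linarith
    have hgj := hposj j hjK.le
    have hxg : advX h n ≤ (C P).flow.g j := by
      have h2 : advX h n ^ 2 ≤ ((C P).flow.g j) ^ 2 := (one_div_le_one_div (pow_pos hgj 2) (pow_pos hxpos 2)).mp hyj
      exact (pow_le_pow_iff_left₀ hxpos.le hgj.le two_ne_zero).mp h2
    exact le_profile_of_two_mul_le (advT_pos h n) (htune.trans hxg)
  -- the whole window: `1∕g_k² ≤ (n+1) + Σ (b − 2⁻ⁿ) < 0`
  have hw := windowSum_ge_betaPro hgen P hI hkK le_rfl
  rw [hend', hg2] at hw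
  have hsum_le : ∑ i ∈ Finset.Ico k K, (b i + (-1) * profile (advT h) ((C P).flow.g i)) ≤ ∑ i ∈ Finset.Ico k K, (b i - c) :=
    Finset.sum_le_sum fun i hi => by
      have := hpen i (Finset.mem_Ico.mp hi).1 (Finset.mem_Ico.mp hi).2
      linarith
  have hpos_k : 0 < 1 / ((C P).flow.g k) ^ 2 := one_div_pos.mpr (pow_pos (hposj k hkK) 2)
  linarith

/-- COROLLARY (for `Gaps/EndDrawdownEverySlopeDecided`) · under `∀ n, ¬ DwSeq b 2⁻ⁿ` there is an every-slope realization of `b` on every box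
`]0,γc]` (`0 < γc`), (C) on every box, realised by the tree's canonical forward-generated construction, WITHOUT `EndpointExistence`.
[cite: Balaban1987RG1, Thm 2 p.259 (first sentence) and Thm 3 p.264] -/
theorem exists_everySlope_realization_not_endpointExistence (h : ∀ n : ℕ, ¬ DwSeq b (((2 : ℝ)⁻¹) ^ n)) {γc : ℝ} (hγc : 0 < γc) :
    ∃ (β : HBeta) (Sβ : B12Beta.OneLoopSplit β), (∀ j, Sβ.β0 j = b j) ∧ EverySlope Sβ γc ∧ (∀ γ, BetaContH γ β) ∧
      ForwardGenerated (modelOf β) β ∧ ¬ EndpointExistence (modelOf β) :=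
  ⟨betaPro b (-1) (advT h), splitPro b (-1) (advT h), fun _ => rfl,
    everySlope_splitPro b (-1) (advT_antitone h) (advT_pos h) hγc, betaContH_betaPro b (-1) (advT h),
    modelOf_forwardGenerated _, not_endpointExistence_adv h (modelOf_forwardGenerated _)⟩

end Adversary

end

end Summit.QuantumFields.BalabanUV.Gaps.EndDrawdownProfile
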